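/-
Origin: expansion seat `planner-pub-hodgecm-pv10-g5-0`, handover #6(2/6) 2026-08-18T15:21:38Z ; rewrite: ^import Pv10g5\.QuotientHolomorphic -> import HodgeCM.PerL34.QuotientHolomorphic (`HOME/pub-hodgecm-pv10-g5/lean/Pv10g5/BallHolomorphic.lean`, md5 40d5018f, 240 lines);
landed by the gen-8 packager in gate run 31 as `HodgeCM/PerL34/BallHolomorphic.lean` (import ^import Pv10g5\.QuotientHolomorphic[ \t]*$→import HodgeCM.PerL34.QuotientHolomorphic ×1; stripped 4 #print/#check/#eval lines).
-/
/-
Origin: pub-hodgecm speedrun cell, seat pv10-g5 (DAG-NODE PROVER #10, gen 5), 2026-08-18.  STAGING for the tree import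
(LEAN-IN-TREE RULE 2026-08-18): tree-shaped (≤ 400 lines, docstring on every decl, general engine and ball/PerL
specialisation in separate files); see `HOME/pub-hodgecm-pv10-g5/MODULE-MAP-pv10.md`.
Target path: `HodgeCM/PerL34/BallHolomorphic.lean`.  Proposed tree home: with the PerL ball-piece files
(`BallQuotientManifold`, `BallCovering`) under `Summits/HodgeConjecture/PerL/…`.
WIP import `Pv10g5.QuotientHolomorphic` ↦ `HodgeCM.PerL34.QuotientHolomorphic` at landing (ONE rewrite); the other
imports are TREE modules (`BallQuotientManifold` = this seat's RUN-30 file, `BallCovering` = pv10-g4's RUN-30 file).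
KERNEL, nothing cited, nothing posited.
-/
import Summits.HodgeConjecture.HodgeCM.PerL34.QuotientHolomorphic
import Summits.HodgeConjecture.HodgeCM.PerL34.BallQuotientManifold
import Summits.HodgeConjecture.HodgeCM.PerL34.BallCovering

/-!
# `𝔹² → Γ\𝔹²` and `Γ₁\𝔹² → Γ\𝔹²` are holomorphic local biholomorphisms (PerL v5 §1.2, ll. 72–75)

PerL v5 §1.2 ll. 72–75 (verbatim): "for torsion-free `Γ`, `P^L_Γ := Γ\𝔹²` is a smooth projective surface, and
there is a neat normal `K_1 ⊂ K_f` of finite index with `P^L_{Γ_1} → P^L_Γ` finite \'etale".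

Ball (ns `HodgeCM.PerL34.BallComplex`, model `𝓘(ℂ, ℂ²)`, `n = ω`, structures `instIsManifoldBall` /
`isManifold_ballQuotient` of `BallQuotientManifold.lean`, engine `QuotientHolomorphic.lean`): every `Γ ≤ U(2,1)`
acts by maps of the analytic groupoid (`actsBy_ball`); for discrete free `Γ`, `𝔹² → Γ\𝔹²` is a holomorphic local
biholomorphism (`contMDiff_ballQuotientMk`, `isLocalDiffeomorph_ballQuotientMk`); for discrete free `Γ₁, Γ` every
map `Γ₁\𝔹² → Γ\𝔹²` over `𝔹²` is one (`contMDiff_of_comp_ballQuotientMk_eq`,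
`isLocalDiffeomorph_of_comp_ballQuotientMk_eq`, packaged as `IsHolEtale`); `𝔹²` is star-convex, so `𝔹²` and
every `Γ\𝔹²` are path-connected (`instPathConnectedSpaceBall`, `pathConnectedSpace_ballQuotient`).

PerL (ns `HodgeCM.PerL34.ArchCompactK`): `isHolEtale_ballOrbitMap` (pv10-g4's `orbitMap` for discrete
`Γ₁ ≤ Γ ≤ G_U(ℝ)`, `Γ` free on `G_U(ℝ)/K_∞`) and the headline `HermSpace3.exists_ballPieces_holomorphicCovering`:
for compact open `K_f ≤ K_H(3)` there is a compact open `K₁ ≤ K_f`, normal of finite index, with EVERY piece map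
`Γ_H(bK₁b⁻¹)'\𝔹² → Γ_H(bK_fb⁻¹)'\𝔹²` both a covering map with fibres of cardinality `[Γ:Γ₁] ∣ [K_f:K₁]`
(pv10-g4's `BallPieceCovering`) and a holomorphic local biholomorphism — "`P^L_{Γ_1} → P^L_Γ` finite étale" in
the complex-analytic category.  NOT claimed: algebraicity / projectivity of `Γ\𝔹²` (PRINT: Baily–Borel /
Kodaira), hence not "étale" in the scheme sense.
`#print axioms` of every result = `[propext, Classical.choice, Quot.sound]`.
-/

noncomputable section

open scoped Matrix Pointwise Manifold ContDiff Topology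
open MulAction Set

/-! ## The ball: `𝔹² → Γ\𝔹²` and `Γ₁\𝔹² → Γ\𝔹²` are holomorphic local biholomorphisms -/

namespace HodgeCM.PerL34.BallComplex

open HodgeCM.PerL34.BallModel HodgeCM.PerL34.QuotientManifold

/-- Every subgroup `Γ ≤ U(2,1)` acts on `𝔹²` by maps of the analytic groupoid `contDiffGroupoid ω 𝓘(ℂ, ℂ²)`. -/
theorem actsBy_ball (Γ : Subgroup U21) : ActsBy Γ Ball (contDiffGroupoid ω 𝓘(ℂ, Fin 2 → ℂ)) :=
  fun γ e he e' he' => by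
    rw [eq_ballChart_of_mem_atlas he, eq_ballChart_of_mem_atlas he']
    exact smul_mem_contDiffGroupoid Γ γ

/-- **`π : 𝔹² → Γ\𝔹²` is holomorphic** (discrete free `Γ ≤ U(2,1)`; complex structures `instIsManifoldBall`,
`isManifold_ballQuotient`). -/
theorem contMDiff_ballQuotientMk (Γ : Subgroup U21) [DiscreteTopology Γ] [IsCancelSMul Γ Ball] :
    ContMDiff 𝓘(ℂ, Fin 2 → ℂ) 𝓘(ℂ, Fin 2 → ℂ) ω
      (Quotient.mk (orbitRel Γ Ball) : Ball → orbitRel.Quotient Γ Ball) :=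
  contMDiff_mk (actsBy_ball Γ)

/-- **`π : 𝔹² → Γ\𝔹²` is a holomorphic local biholomorphism.** -/
theorem isLocalDiffeomorph_ballQuotientMk (Γ : Subgroup U21) [DiscreteTopology Γ] [IsCancelSMul Γ Ball] :
    IsLocalDiffeomorph 𝓘(ℂ, Fin 2 → ℂ) 𝓘(ℂ, Fin 2 → ℂ) ω
      (Quotient.mk (orbitRel Γ Ball) : Ball → orbitRel.Quotient Γ Ball) :=
  isLocalDiffeomorph_mk (actsBy_ball Γ)

/-- The local sections of `π : 𝔹² → Γ\𝔹²` are holomorphic. -/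
theorem contMDiffOn_ballLocalSection (Γ : Subgroup U21) [DiscreteTopology Γ] [IsCancelSMul Γ Ball]
    (z : Ball) : ContMDiffOn 𝓘(ℂ, Fin 2 → ℂ) 𝓘(ℂ, Fin 2 → ℂ) ω (localSection Γ z) (localSection Γ z).source :=
  contMDiffOn_localSection (actsBy_ball Γ) z

/-- **Maps of ball quotients over `𝔹²` are holomorphic**: for discrete free `Γ₁, Γ ≤ U(2,1)` and any
`f : Γ₁\𝔹² → Γ\𝔹²` with `f ∘ π₁ = π` (e.g. `Γ₁ ≤ Γ` and `f = orbitMap`, pv10-g4's `QuotientInStages` /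
`BallCovering`: there `f` is moreover a covering map with fibres of cardinality `[Γ:Γ₁]`), `f` is holomorphic … -/
theorem contMDiff_of_comp_ballQuotientMk_eq (Γ₁ Γ : Subgroup U21) [DiscreteTopology Γ₁] [IsCancelSMul Γ₁ Ball]
    [DiscreteTopology Γ] [IsCancelSMul Γ Ball] (f : orbitRel.Quotient Γ₁ Ball → orbitRel.Quotient Γ Ball)
    (hf : ∀ z : Ball, f (Quotient.mk (orbitRel Γ₁ Ball) z) = Quotient.mk (orbitRel Γ Ball) z) :
    ContMDiff 𝓘(ℂ, Fin 2 → ℂ) 𝓘(ℂ, Fin 2 → ℂ) ω f :=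
  contMDiff_of_comp_mk_eq (actsBy_ball Γ₁) (actsBy_ball Γ) f hf

/-- … and a holomorphic local biholomorphism ("étale" in the complex-analytic category). -/
theorem isLocalDiffeomorph_of_comp_ballQuotientMk_eq (Γ₁ Γ : Subgroup U21) [DiscreteTopology Γ₁]
    [IsCancelSMul Γ₁ Ball] [DiscreteTopology Γ] [IsCancelSMul Γ Ball]
    (f : orbitRel.Quotient Γ₁ Ball → orbitRel.Quotient Γ Ball)
    (hf : ∀ z : Ball, f (Quotient.mk (orbitRel Γ₁ Ball) z) = Quotient.mk (orbitRel Γ Ball) z) :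
    IsLocalDiffeomorph 𝓘(ℂ, Fin 2 → ℂ) 𝓘(ℂ, Fin 2 → ℂ) ω f :=
  isLocalDiffeomorph_of_comp_mk_eq (actsBy_ball Γ₁) (actsBy_ball Γ) f hf

/-! ### Connectedness: `𝔹²` and every `Γ\𝔹²` are path-connected -/

/-- (Ported verbatim from the HodgeCMPerL package; no docstring in the source.) -/
theorem nsq_smul (t : ℝ) (z : Fin 2 → ℂ) : nsq (t • z) = t ^ 2 * nsq z := by
  simp only [nsq, Pi.smul_apply, norm_smul, mul_pow, Real.norm_eq_abs, sq_abs]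
  ring

/-- The origin of `ℂ²` lies in the open unit ball `ballSet`. -/
theorem zero_mem_ballSet : (0 : Fin 2 → ℂ) ∈ ballSet := by
  change nsq 0 < 1
  simp [nsq]

/-- The ball is star-convex about `0` (indeed convex; star-convexity is all we need). -/
theorem starConvex_ballSet : StarConvex ℝ (0 : Fin 2 → ℂ) ballSet := by
  intro y hy a b _ hb hab
  change nsq (a • (0 : Fin 2 → ℂ) + b • y) < 1
  rw [smul_zero, zero_add, nsq_smul]
  have hy' : nsq y < 1 := hy
  have hb1 : b ^ 2 ≤ 1 := by nlinarith
  calc b ^ 2 * nsq y ≤ 1 * nsq y := mul_le_mul_of_nonneg_right hb1 (nsq_nonneg y)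
    _ < 1 := by rw [one_mul]; exact hy'

/-- The open unit ball of `ℂ²` is path-connected (it is star-convex at `0`). -/
theorem isPathConnected_ballSet : IsPathConnected ballSet :=
  starConvex_ballSet.isPathConnected zero_mem_ballSet

/-- `𝔹²` is path-connected … -/
instance instPathConnectedSpaceBall : PathConnectedSpace Ball :=
  isPathConnected_iff_pathConnectedSpace.mp isPathConnected_ballSet

/-- … hence connected. -/
instance instConnectedSpaceBall : ConnectedSpace Ball := inferInstance

/-- **Every `Γ\𝔹²` is path-connected** (so `P^L_Γ` is a CONNECTED complex surface). -/
theorem pathConnectedSpace_ballQuotient (Γ : Subgroup U21) : PathConnectedSpace (orbitRel.Quotient Γ Ball) :=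
  inferInstance

/-- Every quotient `Γ\𝔹²` is connected. -/
theorem connectedSpace_ballQuotient (Γ : Subgroup U21) : ConnectedSpace (orbitRel.Quotient Γ Ball) :=
  inferInstance

/-! ### Holomorphic local biholomorphisms between ball quotients, with the instance data as arguments -/

/-- `f : Γ₁\𝔹² → Γ\𝔹²` is a HOLOMORPHIC LOCAL BIHOLOMORPHISM for the complex structures `isManifold_ballQuotient`
(discreteness / freeness of `Γ₁, Γ` are passed as ARGUMENTS, so that the predicate can be stated where no
instance is in scope, e.g. under binders). -/
def IsHolEtale (Γ₁ Γ : Subgroup U21) (d₁ : DiscreteTopology Γ₁) (c₁ : IsCancelSMul Γ₁ Ball)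
    (d : DiscreteTopology Γ) (c : IsCancelSMul Γ Ball)
    (f : orbitRel.Quotient Γ₁ Ball → orbitRel.Quotient Γ Ball) : Prop :=
  haveI := d₁; haveI := c₁; haveI := d; haveI := c
  ContMDiff 𝓘(ℂ, Fin 2 → ℂ) 𝓘(ℂ, Fin 2 → ℂ) ω f ∧ IsLocalDiffeomorph 𝓘(ℂ, Fin 2 → ℂ) 𝓘(ℂ, Fin 2 → ℂ) ω f

/-- Unfolding lemma for `IsHolEtale`: holomorphic and a holomorphic local diffeomorphism. -/
theorem isHolEtale_iff (Γ₁ Γ : Subgroup U21) [d₁ : DiscreteTopology Γ₁] [c₁ : IsCancelSMul Γ₁ Ball]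
    [d : DiscreteTopology Γ] [c : IsCancelSMul Γ Ball] (f : orbitRel.Quotient Γ₁ Ball → orbitRel.Quotient Γ Ball) :
    IsHolEtale Γ₁ Γ d₁ c₁ d c f ↔
      ContMDiff 𝓘(ℂ, Fin 2 → ℂ) 𝓘(ℂ, Fin 2 → ℂ) ω f ∧ IsLocalDiffeomorph 𝓘(ℂ, Fin 2 → ℂ) 𝓘(ℂ, Fin 2 → ℂ) ω f :=
  Iff.rfl

/-- Any map `Γ₁\𝔹² → Γ\𝔹²` compatible with the two quotient maps is `IsHolEtale` (discrete free `Γ₁, Γ`). -/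
theorem isHolEtale_of_comp_mk_eq (Γ₁ Γ : Subgroup U21) [d₁ : DiscreteTopology Γ₁] [c₁ : IsCancelSMul Γ₁ Ball]
    [d : DiscreteTopology Γ] [c : IsCancelSMul Γ Ball] (f : orbitRel.Quotient Γ₁ Ball → orbitRel.Quotient Γ Ball)
    (hf : ∀ z : Ball, f (Quotient.mk (orbitRel Γ₁ Ball) z) = Quotient.mk (orbitRel Γ Ball) z) :
    IsHolEtale Γ₁ Γ d₁ c₁ d c f :=
  ⟨contMDiff_of_comp_ballQuotientMk_eq Γ₁ Γ f hf, isLocalDiffeomorph_of_comp_ballQuotientMk_eq Γ₁ Γ f hf⟩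

end HodgeCM.PerL34.BallComplex

/-! ## PerL v5 ll. 74–75: `P^L_{Γ_1} → P^L_Γ` is a holomorphic covering ("finite étale", analytically) -/

namespace HodgeCM.PerL34.ArchCompactK

section PerLBall

open HodgeCM.PerL34.Godement HodgeCM.PerL34.Godement.Stages HodgeCM.PerL34.AdelicUnitaryFactorisation
open HodgeCM.PerL34.BallComplex HodgeCM.PerL34.QuotientManifold
open Literature.AlgebraicGeometry.ShimuraVarieties (signatureMatrix)
open HodgeCM.PerL34.BallModel (U21 Ball x₀)
open NumberField

variable (L : CMField) {ι₁ : L →+* ℂ} (V : HermSpace3 L ι₁) {T : GL (Fin 3) ℂ}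
  (hT : (T : Matrix (Fin 3) (Fin 3) ℂ)ᴴ * V.Hm.map (InfinitePlace.mk ι₁).embedding *
    (T : Matrix (Fin 3) (Fin 3) ℂ) = signatureMatrix 2)

include hT

/-- For discrete `Γ₁ ≤ Γ ≤ G_U(ℝ)` with `Γ` free on `G_U(ℝ)/K_∞`, the map of ball quotients
`Γ₁'\𝔹² → Γ'\𝔹²` (`Γ' = archToU21 (Γ)`, pv10-g4's `orbitMap`) is a holomorphic local biholomorphism. -/
theorem isHolEtale_ballOrbitMap (Γ₁ Γ : Subgroup (Uinf L V.Hm)) [DiscreteTopology Γ₁] [DiscreteTopology Γ]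
    (hle : Γ₁ ≤ Γ) (hfree : ∀ q : Uinf L V.Hm ⧸ V.archK T, MulAction.stabilizer (Uinf L V.Hm) q ⊓ Γ = ⊥) :
    IsHolEtale (Γ₁.map (V.archToU21 hT)) (Γ.map (V.archToU21 hT))
      (HodgeCM.HermSpace3.discreteTopology_map_archToU21 V hT Γ₁)
      (isCancelSMul_of_stabilizer_inf_eq_bot _ (stabilizer_ball_eq_bot L V hT Γ₁ fun q =>
        eq_bot_iff.mpr (le_trans (inf_le_inf_left _ hle) (hfree q).le)))
      (HodgeCM.HermSpace3.discreteTopology_map_archToU21 V hT Γ)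
      (isCancelSMul_of_stabilizer_inf_eq_bot _ (stabilizer_ball_eq_bot L V hT Γ hfree))
      (orbitMap (Γ₁.map (V.archToU21 hT)) (Γ.map (V.archToU21 hT)) (Subgroup.map_mono hle) (X := Ball)) :=
  @isHolEtale_of_comp_mk_eq _ _ (_) (_) (_) (_) _ fun z => orbitMap_mk _ _ _ z

/-- Instance term: `Γ_H(bK_fb⁻¹)' ≤ U(2,1)` is discrete for compact `K_f`. -/
theorem discreteTopology_pieceLattice (Kf : Subgroup (Ufin L V.Hm)) (hKc : IsCompact (Kf : Set (Ufin L V.Hm)))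
    (b : Ufin L V.Hm) : DiscreteTopology ((congruenceLattice L V.Hm (MulAut.conj b • Kf)).map (V.archToU21 hT)) :=
  haveI := HodgeCM.HermSpace3.discreteTopology_congruenceLattice L V _ (isCompact_conj_smul Kf hKc b)
  HodgeCM.HermSpace3.discreteTopology_map_archToU21 V hT _

/-- Instance term: `Γ_H(bK_fb⁻¹)'` acts on `𝔹²` with trivial isotropy for compact `K_f ≤ K_H(3)`. -/
theorem isCancelSMul_pieceLattice (Kf : Subgroup (Ufin L V.Hm)) (hKc : IsCompact (Kf : Set (Ufin L V.Hm)))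
    (hK3 : Kf ≤ levelUfin L V.Hm 3) (b : Ufin L V.Hm) :
    IsCancelSMul ((congruenceLattice L V.Hm (MulAut.conj b • Kf)).map (V.archToU21 hT)) Ball :=
  isCancelSMul_of_stabilizer_inf_eq_bot _ (HodgeCM.HermSpace3.shimuraSet_pieces_ball_free L V hT Kf hKc b
    (torsionFree_congruenceLattice_conj L le_rfl hK3 b))

/-- **PerL v5 §1.2 ll. 74–75 ON THE BALL, complex-analytically (KERNEL).**  For a hermitian 3-space `V` over the
CM field `L`, a Sylvester frame `T` at `ι₁` and a compact open level `K_f ≤ K_H(3)`: there is a compact open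
`K₁ ≤ K_f`, `K₁ ≤ K_H(3)`, normal of finite index in `K_f`, such that for EVERY `b ∈ G_U(𝔸_f)` the map of ball
quotients `Γ_H(bK₁b⁻¹)'\𝔹² → Γ_H(bK_fb⁻¹)'\𝔹²` between the (connected, Hausdorff) complex surfaces of
`HermSpace3.isManifold_ballPiece` is (i) a covering map all of whose fibres have exactly `[Γ_H(bK_fb⁻¹) :
Γ_H(bK₁b⁻¹)] ∣ [K_f : K₁]` points (pv10-g4, `BallPieceCovering`) and (ii) a HOLOMORPHIC LOCAL BIHOLOMORPHISM
(`IsHolEtale`: `ContMDiff … ω` and `IsLocalDiffeomorph … ω`) — i.e. "`P^L_{Γ_1} → P^L_Γ` finite étale" in the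
complex-analytic category.  NOT claimed: algebraicity / projectivity (PRINT). -/
theorem _root_.HodgeCM.HermSpace3.exists_ballPieces_holomorphicCovering (Kf : Subgroup (Ufin L V.Hm))
    (hKo : IsOpen (Kf : Set (Ufin L V.Hm))) (hKc : IsCompact (Kf : Set (Ufin L V.Hm)))
    (hK3 : Kf ≤ levelUfin L V.Hm 3) :
    ∃ K₁ : Subgroup (Ufin L V.Hm), ∃ hK1c : IsCompact (K₁ : Set (Ufin L V.Hm)), ∃ hK13 : K₁ ≤ levelUfin L V.Hm 3,
      K₁ ≤ Kf ∧ IsOpen (K₁ : Set (Ufin L V.Hm)) ∧ (K₁.subgroupOf Kf).Normal ∧ (K₁.subgroupOf Kf).FiniteIndex ∧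
      ∀ b : Ufin L V.Hm, BallPieceCovering L V hT K₁ Kf b ∧
        ∃ hle : congruenceLattice L V.Hm (MulAut.conj b • K₁) ≤ congruenceLattice L V.Hm (MulAut.conj b • Kf),
          IsHolEtale ((congruenceLattice L V.Hm (MulAut.conj b • K₁)).map (V.archToU21 hT))
            ((congruenceLattice L V.Hm (MulAut.conj b • Kf)).map (V.archToU21 hT))
            (discreteTopology_pieceLattice L V hT K₁ hK1c b) (isCancelSMul_pieceLattice L V hT K₁ hK1c hK13 b)
            (discreteTopology_pieceLattice L V hT Kf hKc b) (isCancelSMul_pieceLattice L V hT Kf hKc hK3 b)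
            (orbitMap _ _ (Subgroup.map_mono hle) (X := Ball)) := by
  obtain ⟨K₁, h1f, h13, hK1o, hK1c, hN, hFI, hcov⟩ :=
    HodgeCM.HermSpace3.exists_ballPieces_isCoveringMap L V hT Kf hKo hKc hK3
  refine ⟨K₁, hK1c, h13, h1f, hK1o, hN, hFI, fun b => ⟨hcov b, (hcov b).le, ?_⟩⟩
  haveI : DiscreteTopology (congruenceLattice L V.Hm (MulAut.conj b • K₁)) :=
    HodgeCM.HermSpace3.discreteTopology_congruenceLattice L V _ (isCompact_conj_smul K₁ hK1c b)
  haveI : DiscreteTopology (congruenceLattice L V.Hm (MulAut.conj b • Kf)) :=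
    HodgeCM.HermSpace3.discreteTopology_congruenceLattice L V _ (isCompact_conj_smul Kf hKc b)
  exact isHolEtale_ballOrbitMap L V hT _ _ (hcov b).le fun q =>
    stabilizer_inf_eq_bot_of_torsionFree _ (torsionFree_congruenceLattice_conj L le_rfl hK3 b) (V.archK T)
      (V.isCompact_archK T) q

end PerLBall

end HodgeCM.PerL34.ArchCompactK

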